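import Summits.QuantumFields.YangMills.Theorems.BalabanUVNodesN21ExpChartSharpRadius

/-!
# N21 (NE7c) · THE EXPONENTIAL WINDOW IS A CHART: the image of the OPEN Hilbert–Schmidt ball of radius `S ≤ √2·π` under
# `expPtSU` is OPEN in `SU(N)`, and the chart is a homeomorphism of that ball onto it (inverse function theorem through the local
# logarithm; files 23–27 gave injectivity and the invertible differential)

Width seat pub-ymgap-dag-n21-w1 (g4; director-ym №197 ∕ HUMAN RULING D-0149), node N21 = NE7c (NOT PRINTED in [Bałaban 1983–89], NOT
proved), lane K3⁸ `SpineGivenEndpointR13SepCoPHV` (stmt-QuantumFields-27366, KEY MAP v2; lineage K3⁷ stmt-QuantumFields-20544),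
`--kind proof --supports … --as helper`.  File 29 of the seat's chain.  THEOREMS ONLY: 0 `def`, 0 `sorry`; count-neutral.  Imports file 23
`…N21ExpChartSharpRadius` (injectivity `expPtSU_injOn_of_lt_sqrt_two_mul_pi`, `det_duhT_pos_of_norm_lt`; hence pub-balaban's
`ShellMeasureHaarHausdorffSUN` ∕ `…ExpDuhamelSUN` ∕ `…ExpHaarAreaSUN` and the tree's `Literature.Analysis.Matrix.DetExp`) only.  NO Theses import.

WHY.  The tree knows the exponential window as a MEASURABLE object (closed embedding of the closed ball, (CH)₁); files 23–27 fixed its two radii.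
What was missing is the TOPOLOGICAL chart statement: on the open ball the chart is OPEN INTO THE GROUP — the window `exp(B_S)`, `S ≤ √2·π`, is an
open neighbourhood of `1` in `SU(N)` and `expPtSU` restricted to `B_S` is a homeomorphism onto it (an open embedding).  Mathlib has no manifold
structure on `SU(N)`, so the inverse function theorem is run BY HAND through the ambient algebra `M_N(ℂ)`:
(1) the local logarithm `L` = the strict local inverse of `exp : M_N(ℂ) → M_N(ℂ)` at `0` (Mathlib's `HasStrictFDerivAt.localInverse` from
`hasStrictFDerivAt_exp_zero`); (2) for `W ∈ SU(N)` near `1`, `L W ∈ 𝔰𝔲(N)` — NOT by a formula but by UNIQUENESS: `X = L W` and `−X*` are both small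
with `exp(−X*) = (exp X)*⁻¹ = W`, so `X = −X*`, and `det W = 1 = e^{tr X}` with `tr X` small gives `tr X = 0`; (3) for `‖v₀‖ < √2·π` the map
`Ψ(v) = P(L(exp(v)·exp(v₀)*))`, `P` a linear left inverse of the generator embedding, has strict derivative `h ↦ P(Ad_{exp v₀} genSU(T_{v₀} h))`
at `v₀`, injective because `T_{v₀}` is (file 23), hence invertible (equal finite dimension), so `Ψ` maps neighbourhoods of `v₀` ONTO
neighbourhoods of `0` (`HasStrictFDerivAt.map_nhds_eq_of_equiv`); (4) a group element `W` near `exp v₀` has `L(W·exp(v₀)*) ∈ 𝔰𝔲(N)` equal to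
`L(exp(v)·exp(v₀)*)` for some `v` near `v₀` (both lie in `𝔰𝔲(N)`, where `P` is one-to-one), and exponentiating gives `W = exp v`.

WHAT IS PROVED ([folklore]).
* §1 `exists_localLog` — a local logarithm `L` on `M_N(ℂ)`: left ∕ right inverse of `exp` near `0` ∕ `1`, strictly differentiable at `1`, `L 1 = 0`.
* §2 `norm_entry_le_norm`, `norm_trace_le`; ★ `eventually_localLog_mem_lieSU` — near `1`, the local logarithm of a SPECIAL UNITARY matrix is
  skew-Hermitian and trace-free (the uniqueness argument above).
* §3 `exists_leftInverse_genSU` (a continuous linear `P` with `P (genSU v) = v`), `genSU_coordSU_symm`, `eq_of_mem_lieSU_of_apply_eq`.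
* §4 `conj_genSU_mem_lieSU`; ★★ `image_mem_nhds_expPtSU_of_isOpen` (`O` open, `O ⊆ ball 0 (√2·π)`, `v₀ ∈ O ⇒ expPtSU '' O ∈ 𝓝 (expPtSU v₀)`);
  ★★ `isOpen_image_expPtSU_of_isOpen` ∕ `isOpen_image_expPtSU_ball` (`S ≤ √2·π ⇒ IsOpen (expPtSU '' ball 0 S)`);
  `image_ball_subset_interior_expBallSU`; `image_ball_mem_nhds_one` ∕ `expBallSU_mem_nhds_one` ∕ `expWindowSU_mem_nhds` (`0 < S ≤ √2·π`: the
  window about `g` is a neighbourhood of `g`); ★ `isOpenEmbedding_restrict_expPtSU_ball` (the chart restricted to the open `√2·π`-ball is an OPEN EMBEDDING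
  `B_{√2·π} ↪ SU(N)` — with file 23's injectivity radius this is the maximal such ball).

HONEST FRAMING.  [folklore] Lie-group analysis over Mathlib's inverse function theorem and pub-balaban's chart modules BY NAME; no located letter of any
N21 road is touched; types nothing of Bałaban's; (M1) ∕ NE7c NOT PRINTED ∕ NOT proved; **N21 NOT discharged**; K3⁸ NOT claimed; counts unmoved (typed
28∕28 · discharged 5∕27); never a count claim; one finite 𝕋⁴ at fixed ε — R4 would close only the conditional finite-𝕋⁴ rung `BalabanLadder.UV`, NOT
the Yang–Mills mass gap (Clay); nothing about ℝ⁴ ∕ OS.  No decl below carries a cite tag.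
-/

set_option autoImplicit false

noncomputable section

open scoped BigOperators Topology Matrix.Norms.Frobenius
open Set Function Metric Matrix Finset Filter

namespace Summit.QuantumFields.YangMills.Theorems.N21ExpChartOpenImage

open Literature.MathematicalPhysics.QuantumFieldTheory.Balaban1983to89
open Literature.MathematicalPhysics.QuantumFieldTheory.Balaban1983to89.T4AdjointCovarianceUnitary (lieSU mem_lieSU_iff)
open Summit.QuantumFields.BalabanUV.T4Continuum
open Summit.QuantumFields.BalabanUV.T4Continuum.ShellMeasureExpChartSUN
  (SUN ChartSU coordSU genSU expPtSU coe_expPtSU norm_genSU continuous_expPtSU)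
open Summit.QuantumFields.BalabanUV.T4Continuum.ShellMeasureExpDuhamelSUN (genSUL genSUL_apply duhT)
open Summit.QuantumFields.BalabanUV.T4Continuum.ShellMeasureHaarHausdorffSUN
  (MatC expM expM_apply hsInnerProductSpace contDiff_expM genSUL_injective)
open Summit.QuantumFields.BalabanUV.T4Continuum.ShellMeasureExpHaarAreaSUN (DexpM fderiv_expM)
open Summit.QuantumFields.BalabanUV.T4Continuum.ShellMeasureScalingSUN (expBallSU)
open Summit.QuantumFields.YangMills.Theorems.N21ExpChartSharpRadius (det_duhT_pos_of_norm_lt expPtSU_injOn_ball_sqrt_two_mul_pi)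

variable {N : ℕ}

/-! ## §1 The local logarithm of `M_N(ℂ)` at `1` -/

section Log

/-- **A LOCAL LOGARITHM**: `exp : M_N(ℂ) → M_N(ℂ)` has strict derivative the identity at `0` (Mathlib `hasStrictFDerivAt_exp_zero`), so its local
inverse `L` at `0 ↦ 1` satisfies `L (exp X) = X` near `0`, `exp (L W) = W` near `1`, is strictly differentiable at `1` with derivative the identity,
and `L 1 = 0`.  (Stated as an existence: no `def`.) [folklore] -/
theorem exists_localLog :
    ∃ L : MatC N → MatC N,
      (∀ᶠ X in 𝓝 (0 : MatC N), L (NormedSpace.exp X) = X) ∧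
      (∀ᶠ W in 𝓝 (1 : MatC N), NormedSpace.exp (L W) = W) ∧
      HasStrictFDerivAt L ((ContinuousLinearEquiv.refl ℝ (MatC N) : MatC N ≃L[ℝ] MatC N) : MatC N →L[ℝ] MatC N) 1 ∧
      L 1 = 0 := by
  have h : HasStrictFDerivAt (fun X : MatC N => NormedSpace.exp X)
      ((ContinuousLinearEquiv.refl ℝ (MatC N) : MatC N ≃L[ℝ] MatC N) : MatC N →L[ℝ] MatC N) 0 :=
    hasStrictFDerivAt_exp_zero (𝕂 := ℝ) (𝔸 := MatC N)
  refine ⟨h.localInverse _ _ _, h.eventually_left_inverse, ?_, ?_, ?_⟩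
  · have h2 := h.eventually_right_inverse
    simp only [NormedSpace.exp_zero] at h2
    exact h2
  · have h3 := h.to_localInverse
    simp only [NormedSpace.exp_zero] at h3
    exact h3
  · have h4 := h.localInverse_apply_image
    simp only [NormedSpace.exp_zero] at h4
    exact h4

end Log

/-! ## §2 Near `1` the local logarithm of a special unitary matrix is skew-Hermitian and trace-free -/

section SkewHermitian

/-- `‖X‖²_HS = Σ_{i,j} |X_ij|²`. [folklore] -/
theorem norm_sq_eq_sum_sq_entries (X : MatC N) : ‖X‖ ^ 2 = ∑ i, ∑ j, ‖X i j‖ ^ 2 := by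
  letI : InnerProductSpace ℝ (MatC N) := hsInnerProductSpace
  rw [← real_inner_self_eq_norm_sq, Literature.MathematicalPhysics.QuantumLattice.frobenius_inner_def,
    MatrixNorms.sum_norm_sq_eq_re_trace]

/-- every entry is bounded by the Hilbert–Schmidt norm. [folklore] -/
theorem norm_entry_le_norm (X : MatC N) (i j : Fin N) : ‖X i j‖ ≤ ‖X‖ := by
  have h1 : ‖X i j‖ ^ 2 ≤ ‖X‖ ^ 2 := by
    rw [norm_sq_eq_sum_sq_entries]
    calc ‖X i j‖ ^ 2 ≤ ∑ j', ‖X i j'‖ ^ 2 :=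
          single_le_sum (f := fun j' => ‖X i j'‖ ^ 2) (fun _ _ => sq_nonneg _) (mem_univ j)
      _ ≤ ∑ i', ∑ j', ‖X i' j'‖ ^ 2 :=
          single_le_sum (f := fun i' => ∑ j', ‖X i' j'‖ ^ 2) (fun _ _ => sum_nonneg fun _ _ => sq_nonneg _) (mem_univ i)
  exact (pow_le_pow_iff_left₀ (norm_nonneg _) (norm_nonneg X) two_ne_zero).mp h1

/-- `|tr X| ≤ N·‖X‖_HS`. [folklore] -/
theorem norm_trace_le (X : MatC N) : ‖X.trace‖ ≤ N * ‖X‖ := by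
  calc ‖X.trace‖ = ‖∑ i, X i i‖ := by rw [Matrix.trace]; rfl
    _ ≤ ∑ i, ‖X i i‖ := norm_sum_le _ _
    _ ≤ ∑ _i : Fin N, ‖X‖ := sum_le_sum fun i _ => norm_entry_le_norm X i i
    _ = N * ‖X‖ := by rw [sum_const, card_univ, Fintype.card_fin, nsmul_eq_mul]

/-- ★ **NEAR `1`, THE LOCAL LOGARITHM OF A SPECIAL UNITARY MATRIX IS IN `𝔰𝔲(N)`.**  With `X = L W`: `X` and `−Xᴴ` are both small and
`exp(−Xᴴ) = W` too (`exp Xᴴ = (exp X)ᴴ = Wᴴ` and `Wᴴ = exp(−X)` since both invert `W`), so the local left inverse forces `−Xᴴ = X`; and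
`det W = e^{tr X} = 1` with `|tr X| < 2π` forces `tr X = 0`. [folklore] -/
theorem eventually_localLog_mem_lieSU {L : MatC N → MatC N}
    (hL1 : ∀ᶠ X in 𝓝 (0 : MatC N), L (NormedSpace.exp X) = X)
    (hL2 : ∀ᶠ W in 𝓝 (1 : MatC N), NormedSpace.exp (L W) = W)
    (hLc : ContinuousAt L 1) (hL0 : L 1 = 0) :
    ∀ᶠ W in 𝓝 (1 : MatC N), W ∈ Matrix.specialUnitaryGroup (Fin N) ℂ → L W ∈ lieSU (Fin N) := by
  -- a ball on which `L ∘ exp = id`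
  obtain ⟨ε, hε, hball⟩ := Metric.eventually_nhds_iff.mp hL1
  -- near `1`: `‖L W‖ < min ε (2π/(N+1))` (continuity of `L` at `1`, `L 1 = 0`) and `exp (L W) = W`
  have hδ : 0 < min ε (2 * Real.pi / (N + 1)) := lt_min hε (by positivity)
  have hsmall : ∀ᶠ W in 𝓝 (1 : MatC N), ‖L W‖ < min ε (2 * Real.pi / (N + 1)) := by
    have h := (hLc.tendsto).eventually (Metric.ball_mem_nhds (L 1) hδ)
    refine h.mono fun W hW => ?_
    rwa [hL0, dist_zero_right] at hW
  filter_upwards [hsmall, hL2] with W hWs hWexp hWSU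
  set X : MatC N := L W with hXdef
  have hXε : ‖X‖ < ε := hWs.trans_le (min_le_left _ _)
  have hXπ : ‖X‖ < 2 * Real.pi / (N + 1) := hWs.trans_le (min_le_right _ _)
  -- `W` is unitary: `Wᴴ W = 1`
  have hWU : Wᴴ * W = 1 := by
    rw [← star_eq_conjTranspose]; exact Matrix.mem_unitaryGroup_iff'.mp hWSU.1
  -- `exp(−X)` is a right inverse of `W`, so `Wᴴ = exp(−X)`
  have hWinv : W * NormedSpace.exp (-X) = 1 := by
    rw [← hWexp]
    calc NormedSpace.exp X * NormedSpace.exp (-X) = NormedSpace.exp (X + -X) :=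
          (NormedSpace.exp_add_of_commute (Commute.neg_right (Commute.refl X))).symm
      _ = 1 := by rw [add_neg_cancel, NormedSpace.exp_zero]
  have hWH : Wᴴ = NormedSpace.exp (-X) := by
    calc Wᴴ = Wᴴ * (W * NormedSpace.exp (-X)) := by rw [hWinv, Matrix.mul_one]
      _ = NormedSpace.exp (-X) := by rw [← Matrix.mul_assoc, hWU, Matrix.one_mul]
  -- `exp (Xᴴ) = Wᴴ = exp (−X)`, both arguments in the injectivity ball ⇒ `Xᴴ = −X`
  have hexpH : NormedSpace.exp Xᴴ = NormedSpace.exp (-X) := by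
    rw [Matrix.exp_conjTranspose, hWexp, hWH]
  have hmemH : Xᴴ ∈ Metric.ball (0 : MatC N) ε := by
    rw [Metric.mem_ball, dist_zero_right, Matrix.frobenius_norm_conjTranspose]; exact hXε
  have hmemN : -X ∈ Metric.ball (0 : MatC N) ε := by
    rw [Metric.mem_ball, dist_zero_right, norm_neg]; exact hXε
  have hskew : star X = -X := by
    rw [star_eq_conjTranspose, ← hball hmemH, hexpH, hball hmemN]
  -- trace: `det W = 1 = exp (tr X)`, `|tr X| < 2π`
  have hdet : Complex.exp X.trace = 1 := by
    rw [congr_fun Complex.exp_eq_exp_ℂ X.trace, ← Literature.Analysis.Matrix.det_exp_eq_exp_trace, hWexp]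
    exact hWSU.2
  obtain ⟨n, hn⟩ := Complex.exp_eq_one_iff.mp hdet
  have htr_small : ‖X.trace‖ < 2 * Real.pi := by
    have hN1 : (0 : ℝ) < N + 1 := by positivity
    calc ‖X.trace‖ ≤ N * ‖X‖ := norm_trace_le X
      _ ≤ (N + 1) * ‖X‖ := by nlinarith [norm_nonneg X]
      _ < (N + 1) * (2 * Real.pi / (N + 1)) := by gcongr
      _ = 2 * Real.pi := mul_div_cancel₀ _ hN1.ne'
  have hn0 : n = 0 := by
    have h1 : ‖X.trace‖ = |(n : ℝ)| * (2 * Real.pi) := by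
      rw [hn, norm_mul, Complex.norm_intCast, norm_mul, Complex.norm_I, mul_one, Complex.norm_mul, Complex.norm_two,
        Complex.norm_real, Real.norm_of_nonneg Real.pi_pos.le]
    rw [h1] at htr_small
    have h2 : |(n : ℝ)| < 1 := by
      by_contra hcon
      push Not at hcon
      have := mul_le_mul_of_nonneg_right hcon Real.two_pi_pos.le
      linarith
    have h3 := abs_lt.mp h2
    have h4 : (-1 : ℤ) < n := by exact_mod_cast h3.1
    have h5 : n < (1 : ℤ) := by exact_mod_cast h3.2
    omega
  have htr : X.trace = 0 := by rw [hn, hn0]; simp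
  exact mem_lieSU_iff.mpr ⟨hskew, htr⟩

end SkewHermitian

/-! ## §3 A left inverse of the generator embedding -/

section LeftInverse

/-- a continuous linear LEFT INVERSE `P` of the generator embedding: `P (genSU v) = v` (finite dimension). [folklore] -/
theorem exists_leftInverse_genSU : ∃ P : MatC N →L[ℝ] ChartSU N, ∀ v : ChartSU N, P (genSU v) = v := by
  obtain ⟨Pl, hPl⟩ := LinearMap.exists_leftInverse_of_injective (genSUL (N := N) : ChartSU N →ₗ[ℝ] MatC N)
    (LinearMap.ker_eq_bot.mpr genSUL_injective)
  refine ⟨LinearMap.toContinuousLinearMap Pl, fun v => ?_⟩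
  have h := LinearMap.congr_fun hPl v
  rw [LinearMap.comp_apply, LinearMap.id_apply, ContinuousLinearMap.coe_coe, genSUL_apply] at h
  exact h

/-- every element of `𝔰𝔲(N)` is a generator: `genSU (coordSU⁻¹ ⟨Y, _⟩) = Y`. [folklore] -/
theorem genSU_coordSU_symm {Y : MatC N} (hY : Y ∈ lieSU (Fin N)) : genSU ((coordSU (N := N)).symm ⟨Y, hY⟩) = Y := by
  rw [genSU, LinearIsometryEquiv.apply_symm_apply]

/-- a left inverse of the generator embedding is ONE-TO-ONE ON `𝔰𝔲(N)`. [folklore] -/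
theorem eq_of_mem_lieSU_of_apply_eq {P : MatC N →L[ℝ] ChartSU N} (hP : ∀ v : ChartSU N, P (genSU v) = v)
    {Y Y' : MatC N} (hY : Y ∈ lieSU (Fin N)) (hY' : Y' ∈ lieSU (Fin N)) (h : P Y = P Y') : Y = Y' := by
  rw [← genSU_coordSU_symm hY, ← genSU_coordSU_symm hY', hP, hP] at h
  rw [← genSU_coordSU_symm hY, ← genSU_coordSU_symm hY', h]

end LeftInverse

/-! ## §4 The image of the open ball is open; the chart is an open embedding -/

section Open

/-- conjugating a generator by a unitary stays in `𝔰𝔲(N)`. [folklore] -/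
theorem conj_genSU_mem_lieSU (U : MatC N) (hU : U ∈ Matrix.unitaryGroup (Fin N) ℂ) (w : ChartSU N) :
    U * genSU w * star U ∈ lieSU (Fin N) := by
  obtain ⟨hskew, htr⟩ := ShellMeasureExpChartSUN.genSU_mem w
  refine mem_lieSU_iff.mpr ⟨?_, ?_⟩
  · rw [star_mul, star_mul, star_star, hskew, Matrix.neg_mul, Matrix.mul_neg, Matrix.mul_assoc]
  · rw [Matrix.trace_mul_cycle, Matrix.mem_unitaryGroup_iff'.mp hU, Matrix.one_mul, htr]

/-- ★★ **THE IMAGE OF AN OPEN SUBSET OF THE `√2·π`-BALL IS A NEIGHBOURHOOD OF EACH OF ITS POINTS**: for `O` open,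
`O ⊆ ball 0 (√2·π)`, `v₀ ∈ O`: `expPtSU '' O ∈ 𝓝 (expPtSU v₀)` — the inverse function theorem run through the local logarithm (§1–§3 and
file 23's invertible `T_{v₀}`). [folklore] -/
theorem image_mem_nhds_expPtSU_of_isOpen {O : Set (ChartSU N)} (hO : IsOpen O)
    (hOsub : O ⊆ Metric.ball (0 : ChartSU N) (Real.sqrt 2 * Real.pi)) {v₀ : ChartSU N} (hv₀ : v₀ ∈ O) :
    expPtSU '' O ∈ 𝓝 (expPtSU v₀) := by
  have hv₀lt : ‖v₀‖ < Real.sqrt 2 * Real.pi := mem_ball_zero_iff.mp (hOsub hv₀)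
  obtain ⟨L, hL1, hL2, hL3, hL0⟩ := exists_localLog (N := N)
  have hLc : ContinuousAt L 1 := hL3.continuousAt
  have hLsu := eventually_localLog_mem_lieSU hL1 hL2 hLc hL0
  obtain ⟨P, hP⟩ := exists_leftInverse_genSU (N := N)
  -- the reference point and its inverse
  set U₀ : MatC N := expM v₀ with hU₀def
  have hU₀SU : U₀ ∈ Matrix.specialUnitaryGroup (Fin N) ℂ := (expPtSU v₀).2
  have hU₀U : U₀ * star U₀ = 1 := Matrix.mem_unitaryGroup_iff.mp hU₀SU.1
  have hU₀U' : star U₀ * U₀ = 1 := Matrix.mem_unitaryGroup_iff'.mp hU₀SU.1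
  have hstarSU : star U₀ ∈ Matrix.specialUnitaryGroup (Fin N) ℂ := ((expPtSU v₀)⁻¹).2
  -- `Φ v = exp v · U₀*` and `Ψ = P ∘ L ∘ Φ`
  set Φ : ChartSU N → MatC N := fun v => expM v * star U₀ with hΦdef
  have hΦv₀ : Φ v₀ = 1 := hU₀U
  have hΦcont : Continuous Φ := ShellMeasureHaarHausdorffSUN.continuous_expM.mul continuous_const
  have hΦSU : ∀ v, Φ v ∈ Matrix.specialUnitaryGroup (Fin N) ℂ := fun v => Submonoid.mul_mem _ (expPtSU v).2 hstarSU
  -- strict derivatives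
  have hexpM : HasStrictFDerivAt (expM (N := N)) (DexpM v₀) v₀ :=
    (contDiff_expM (N := N) (n := 1)).contDiffAt.hasStrictFDerivAt' (ShellMeasureExpHaarAreaSUN.hasFDerivAt_expM v₀) one_ne_zero
  have hΦ := hexpM.mul_const' (star U₀)
  have hL3' : HasStrictFDerivAt L ((ContinuousLinearEquiv.refl ℝ (MatC N) : MatC N ≃L[ℝ] MatC N) : MatC N →L[ℝ] MatC N)
      (Φ v₀) := by rw [hΦv₀]; exact hL3
  -- `Ψ = P ∘ L ∘ Φ` and its derivative `D h = P (U₀ · genSU (T h) · U₀*)`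
  obtain ⟨D, hΨ, hDapply⟩ : ∃ D : ChartSU N →L[ℝ] ChartSU N,
      HasStrictFDerivAt (fun v => P (L (Φ v))) D v₀ ∧ ∀ h, D h = P (U₀ * genSU (duhT v₀ h) * star U₀) := by
    refine ⟨_, P.hasStrictFDerivAt.comp v₀ (hL3'.comp v₀ hΦ), fun h => ?_⟩
    simp only [ContinuousLinearMap.comp_apply, _root_.smul_apply, MulOpposite.smul_eq_mul_unop, MulOpposite.unop_op]
    rfl
  have hTinj : Injective (duhT v₀) :=
    (LinearMap.equivOfDetNeZero (duhT v₀ : ChartSU N →ₗ[ℝ] ChartSU N) (det_duhT_pos_of_norm_lt hv₀lt).ne').injective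
  have hDinj : Injective D := by
    intro h₁ h₂ h12
    rw [hDapply, hDapply] at h12
    have hmem := fun h => conj_genSU_mem_lieSU U₀ hU₀SU.1 (duhT v₀ h)
    have hY := eq_of_mem_lieSU_of_apply_eq hP (hmem h₁) (hmem h₂) h12
    have hgen : genSU (duhT v₀ h₁) = genSU (duhT v₀ h₂) := by
      have := congrArg (fun Y => star U₀ * Y * U₀) hY
      simpa only [Matrix.mul_assoc, hU₀U', Matrix.mul_one, ← Matrix.mul_assoc _ U₀, Matrix.one_mul] using this
    have hT : duhT v₀ h₁ = duhT v₀ h₂ :=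
      (coordSU (N := N)).injective (Subtype.ext hgen)
    exact hTinj hT
  -- hence an equivalence (equal finite dimensions), and `Ψ` maps `𝓝 v₀` onto `𝓝 0`
  have hDbij : Bijective (D : ChartSU N →ₗ[ℝ] ChartSU N) :=
    ⟨hDinj, (LinearMap.injective_iff_surjective (f := (D : ChartSU N →ₗ[ℝ] ChartSU N))).mp hDinj⟩
  set e : ChartSU N ≃L[ℝ] ChartSU N := (LinearEquiv.ofBijective _ hDbij).toContinuousLinearEquiv with hedef
  have he : (e : ChartSU N →L[ℝ] ChartSU N) = D := by
    ext x; rfl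
  have hΨe : HasStrictFDerivAt (fun v => P (L (Φ v))) (e : ChartSU N →L[ℝ] ChartSU N) v₀ := he ▸ hΨ
  have hmap := hΨe.map_nhds_eq_of_equiv
  have hΨv₀ : P (L (Φ v₀)) = 0 := by rw [hΦv₀, hL0, map_zero]
  rw [hΨv₀] at hmap
  -- the good neighbourhood of `v₀` inside `O`
  have hV : O ∩ Φ ⁻¹' {W | NormedSpace.exp (L W) = W} ∩
      Φ ⁻¹' {W | W ∈ Matrix.specialUnitaryGroup (Fin N) ℂ → L W ∈ lieSU (Fin N)} ∈ 𝓝 v₀ := by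
    refine inter_mem (inter_mem (hO.mem_nhds hv₀) ?_) ?_
    · exact hΦcont.continuousAt.preimage_mem_nhds (by rw [hΦv₀]; exact hL2)
    · exact hΦcont.continuousAt.preimage_mem_nhds (by rw [hΦv₀]; exact hLsu)
  have himg : (fun v => P (L (Φ v))) '' (O ∩ Φ ⁻¹' {W | NormedSpace.exp (L W) = W} ∩
      Φ ⁻¹' {W | W ∈ Matrix.specialUnitaryGroup (Fin N) ℂ → L W ∈ lieSU (Fin N)}) ∈ 𝓝 (0 : ChartSU N) := by
    rw [← hmap]; exact image_mem_map hV
  -- pull back along `W ↦ P (L (W · U₀*))`, continuous at `expPtSU v₀` with value `0`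
  set G : SUN N → MatC N := fun W => (W : MatC N) * star U₀ with hGdef
  have hGcont : Continuous G := continuous_subtype_val.mul continuous_const
  have hGv₀ : G (expPtSU v₀) = 1 := hU₀U
  have hGSU : ∀ W : SUN N, G W ∈ Matrix.specialUnitaryGroup (Fin N) ℂ := fun W => Submonoid.mul_mem _ W.2 hstarSU
  have hPLG : ContinuousAt (fun W : SUN N => P (L (G W))) (expPtSU v₀) := by
    refine P.continuous.continuousAt.comp (ContinuousAt.comp ?_ hGcont.continuousAt)
    rw [hGv₀]; exact hLc
  have hPLGv₀ : P (L (G (expPtSU v₀))) = 0 := by rw [hGv₀, hL0, map_zero]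
  have hN1 : G ⁻¹' {W | NormedSpace.exp (L W) = W} ∈ 𝓝 (expPtSU v₀) :=
    hGcont.continuousAt.preimage_mem_nhds (by rw [hGv₀]; exact hL2)
  have hN2 : G ⁻¹' {W | W ∈ Matrix.specialUnitaryGroup (Fin N) ℂ → L W ∈ lieSU (Fin N)} ∈ 𝓝 (expPtSU v₀) :=
    hGcont.continuousAt.preimage_mem_nhds (by rw [hGv₀]; exact hLsu)
  have hN3 := hPLG.preimage_mem_nhds (by rw [hPLGv₀]; exact himg)
  filter_upwards [hN1, hN2, hN3] with W hW1 hW2 hW3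
  obtain ⟨v, ⟨⟨hvO, hvexp⟩, hvsu⟩, hvW⟩ := hW3
  -- `L (Φ v)` and `L (G W)` lie in `𝔰𝔲(N)` and have the same image under `P`: they are equal
  have hY : L (Φ v) = L (G W) := eq_of_mem_lieSU_of_apply_eq hP (hvsu (hΦSU v)) (hW2 (hGSU W)) hvW
  -- exponentiate: `Φ v = G W`, i.e. `exp v · U₀* = W · U₀*`, so `exp v = W`
  have hΦG : Φ v = G W := by rw [← hvexp, hY]; exact hW1
  refine ⟨v, hvO, Subtype.ext ?_⟩
  have h := congrArg (fun Y => Y * U₀) hΦG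
  have h2 : expM v = (W : MatC N) := by
    simpa only [hΦdef, hGdef, Matrix.mul_assoc, hU₀U', Matrix.mul_one] using h
  exact h2

/-- ★★ **THE IMAGE OF AN OPEN SUBSET OF THE `√2·π`-BALL IS OPEN IN `SU(N)`.** [folklore] -/
theorem isOpen_image_expPtSU_of_isOpen {O : Set (ChartSU N)} (hO : IsOpen O)
    (hOsub : O ⊆ Metric.ball (0 : ChartSU N) (Real.sqrt 2 * Real.pi)) : IsOpen (expPtSU '' O) := by
  rw [isOpen_iff_mem_nhds]
  rintro _ ⟨v₀, hv₀, rfl⟩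
  exact image_mem_nhds_expPtSU_of_isOpen hO hOsub hv₀

/-- ★★ **THE IMAGE OF THE OPEN BALL OF RADIUS `S ≤ √2·π` IS OPEN IN `SU(N)`** — the open window is an honest chart domain. [folklore] -/
theorem isOpen_image_expPtSU_ball {S : ℝ} (hS : S ≤ Real.sqrt 2 * Real.pi) :
    IsOpen (expPtSU '' Metric.ball (0 : ChartSU N) S) :=
  isOpen_image_expPtSU_of_isOpen Metric.isOpen_ball (Metric.ball_subset_ball hS)

/-- the open window lies in the INTERIOR of the closed window `expBallSU S` (`S ≤ √2·π`). [folklore] -/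
theorem image_ball_subset_interior_expBallSU {S : ℝ} (hS : S ≤ Real.sqrt 2 * Real.pi) :
    expPtSU '' Metric.ball (0 : ChartSU N) S ⊆ interior (expBallSU S) :=
  interior_maximal (image_mono Metric.ball_subset_closedBall) (isOpen_image_expPtSU_ball hS)

/-- the open window of radius `0 < S ≤ √2·π` is a NEIGHBOURHOOD OF `1` in `SU(N)` (`expPtSU 0 = 1`). [folklore] -/
theorem image_ball_mem_nhds_one {S : ℝ} (hS0 : 0 < S) (hS : S ≤ Real.sqrt 2 * Real.pi) :
    expPtSU '' Metric.ball (0 : ChartSU N) S ∈ 𝓝 (1 : SUN N) := by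
  rw [← ShellMeasureExpChartSUN.expPtSU_zero]
  exact image_mem_nhds_expPtSU_of_isOpen Metric.isOpen_ball (Metric.ball_subset_ball hS) (Metric.mem_ball_self hS0)

/-- … hence so is the closed window `expBallSU S` of the chart road (`0 < S ≤ √2·π`). [folklore] -/
theorem expBallSU_mem_nhds_one {S : ℝ} (hS0 : 0 < S) (hS : S ≤ Real.sqrt 2 * Real.pi) :
    expBallSU S ∈ 𝓝 (1 : SUN N) :=
  Filter.mem_of_superset (image_ball_mem_nhds_one hS0 hS) (image_mono Metric.ball_subset_closedBall)

/-- … and every WINDOW `g · exp B̄_S` of the chart road is a neighbourhood of its centre `g` (`0 < S ≤ √2·π`; left translation is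
continuous). [folklore] -/
theorem expWindowSU_mem_nhds (g : SUN N) {S : ℝ} (hS0 : 0 < S) (hS : S ≤ Real.sqrt 2 * Real.pi) :
    ShellMeasureScalingSUN.expWindowSU g S ∈ 𝓝 g := by
  have hc : ContinuousAt (fun W : SUN N => g⁻¹ * W) g := (continuous_const.mul continuous_id).continuousAt
  have hset : (fun W : SUN N => g⁻¹ * W) ⁻¹' expBallSU S = ShellMeasureScalingSUN.expWindowSU g S := by
    ext W
    constructor
    · intro hW
      exact ⟨g⁻¹ * W, hW, by show g * (g⁻¹ * W) = W; rw [mul_inv_cancel_left]⟩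
    · rintro ⟨U, hU, rfl⟩
      show g⁻¹ * (g * U) ∈ expBallSU S
      rwa [inv_mul_cancel_left]
  rw [← hset]
  exact hc.preimage_mem_nhds (by rw [inv_mul_cancel]; exact expBallSU_mem_nhds_one hS0 hS)

/-- ★ **THE CHART RESTRICTED TO THE OPEN `√2·π`-BALL IS AN OPEN EMBEDDING INTO `SU(N)`** (continuous; one-to-one by file 23; open by the
above): a homeomorphism of `B_{√2·π} ⊂ E_N` onto an open subset of the group. [folklore] -/
theorem isOpenEmbedding_restrict_expPtSU_ball :
    Topology.IsOpenEmbedding ((Metric.ball (0 : ChartSU N) (Real.sqrt 2 * Real.pi)).restrict (expPtSU (N := N))) := by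
  refine Topology.IsOpenEmbedding.of_continuous_injective_isOpenMap (continuous_expPtSU.comp continuous_subtype_val)
    (injOn_iff_injective.mp expPtSU_injOn_ball_sqrt_two_mul_pi) fun U hU => ?_
  have hval : IsOpen (Subtype.val '' U : Set (ChartSU N)) := Metric.isOpen_ball.isOpenMap_subtype_val U hU
  have hsub : (Subtype.val '' U : Set (ChartSU N)) ⊆ Metric.ball (0 : ChartSU N) (Real.sqrt 2 * Real.pi) := by
    rintro _ ⟨x, _, rfl⟩; exact x.2
  rw [Set.restrict_eq, image_comp]
  exact isOpen_image_expPtSU_of_isOpen hval hsub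

end Open

end Summit.QuantumFields.YangMills.Theorems.N21ExpChartOpenImage

end
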